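import Summits.QuantumFields.YangMills.Theorems.GradientFlowWitnessFlowedResponseFloorWeakCoupling
import HarnessLib

/-!
# Route `GradientFlowWitness`, crux `FlowedResponseFloor` (stmt-QuantumFields-25684): THE WITNESS UNIT IS PINNED FROM
# BELOW — every unit carrying the flowed-response floor (crux form or femto-window form `stub_window`) satisfies
# `a(β)⁸ ≤ C (1 + log β)/β`, hence `a(β) ≤ β^{−c}` for every `c < 1/8` (hypothesis-free, every compact `G`)

Helper file of the prover seat `ym-line-gfw-p1` (gen 2), `--supports stmt-QuantumFields-25684`, R3/RECORD framing.
The crux `FlowedResponseFloor` and the registered stub `stub_window : FlowedResponseFloorWindow` of its BC3 skeleton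
(`Cruxes/FlowedResponseFloor/Lines/birth.lean`) quantify `∃ (r, a)`: SOME unit `a(β) → 0` carries, at every femto radius,
a floor `ε₁ ≤ |resp G r a ρ₀ w v β L|` on the tori `Λ₅ ≤ a(β)L` (crux) resp. `Λ₅ ≤ a(β)L ≤ Λ₆`, every `Λ₆`, `β ≥ β₆(Λ₆)`
(window).  The prover record of this seat (item evidence `PROVER-RECORD-stub_window.md`) explains informally why any such
unit is pinned two-sidedly to the physical lattice spacing `a_phys(β) ≍ e^{−β/(4Nb₀)}`.  This file makes the LOWER half
of that pinning a theorem, in the only form provable without a construction of the theory: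

* `unit_pow_le_of_windowFloor` — if `(r, a)` carries the WINDOW floor data at one radius, then
  `a(β)⁸ ≤ C (1 + log β)/β` for all large `β` (`C = K(5M)⁸/ε₁`, `M = max Λ₅ 1`, `K` the constant of
  `abs_resp_le_weakCoupling`): in the window `[M, M+1]` sits the admissible torus `L = ⌈M/a(β)⌉₊` with
  `2L+1 ≤ 5M/a(β)`, on which the floor `ε₁` meets the ceiling `K(2L+1)⁸(1 + log β)/β`;
* `unit_pow_le_of_floor` — the same from the CRUX floor data (which imply the window data);
* `eventually_unit_le_rpow_of_windowFloor` — hence `a(β) ≤ β^{−c}` eventually, for every `c < 1/8`: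
  NO POWER-LAW (or slower) UNIT CAN WITNESS `FlowedResponseFloor` OR `stub_window`, for any compact gauge group.

HONEST FRAMING.  This is a tightness statement about the `∃ a` of the crux (the regime "unit slower than physical" of
the record's §3 (i), certified with the crude exponent `1/8`); it neither proves nor refutes `stub_window` /
`FlowedResponseFloor` (the physical unit decays exponentially and is untouched), and the UPPER half of the pinning (units
faster than `a_phys` fail by clustering) would need a mass gap and is not claimed.  Nothing of `BalabanLadder.NT`, any
OS leg or the Yang–Mills mass gap is proved.  The same two lines pin the unit of every bare mirror floor (e.g. clause (i)
of `LowerBounds` in `BalabanLadder.NT`), since only `|observable| = O(volume)` and the mean-plaquette budget are used.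
-/

set_option autoImplicit false

noncomputable section

open scoped BigOperators Topology
open Filter
open Literature.MathematicalPhysics.QuantumFieldTheory hiding ZdEdge
open Literature.MathematicalPhysics.QuantumLattice

namespace Summit.QuantumFields.YangMills.Cruxes.FlowedResponseFloor.WindowSplit

section Pinning

variable (G : Type) [Group G] [TopologicalSpace G] [IsTopologicalGroup G] [CompactSpace G]
  [MeasurableSpace G] [BorelSpace G] (r : LatticeRep G)

/-- A Schwartz function is bounded. [folklore] -/
theorem exists_abs_le_of_schwartz (f : SchwartzMap (EuclideanSpace ℝ (Fin 4)) ℝ) : ∃ C : ℝ, ∀ z, |f z| ≤ C := by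
  obtain ⟨C, -, hC⟩ := f.decay 0 0
  refine ⟨C, fun z => ?_⟩
  have h := hC z
  rw [pow_zero, one_mul, norm_iteratedFDeriv_zero, Real.norm_eq_abs] at h
  exact h

/-- **THE WITNESS UNIT IS PINNED FROM BELOW (window form).**  Let `(r, a)` carry the femto-WINDOW floor data of
`FlowedResponseFloorWindow` at one radius: `ε₁ > 0` and, for every window ceiling `Λ₆`, a threshold `β₆` with
`ε₁ ≤ |resp(β, L)|` whenever `β ≥ max β₅ β₆` and `Λ₅ ≤ a(β)L ≤ Λ₆`.  Then there are `C ≥ 0` and `β₀` with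
`a(β)⁸ ≤ C (1 + log β)/β` for all `β ≥ β₀` — the unit decays at least like `(log β/β)^{1/8}`.
(Use the window `Λ₆ = M + 1`, `M = max Λ₅ 1`, the admissible torus `L = ⌈M/a(β)⌉₊`, for which `2L+1 ≤ 5M/a(β)`, and
`abs_resp_le_weakCoupling`.)  Every power-law or slower unit is thereby excluded as a witness of the crux
`FlowedResponseFloor` / of `stub_window`; the physical unit `a ≍ e^{−β/(4Nb₀)}` is of course not. -/
theorem unit_pow_le_of_windowFloor {a : ℝ → ℝ} (ha : ∀ β, 0 < a β) (ha0 : Tendsto a atTop (𝓝 0))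
    {ρ₀ ε₁ β₅ Λ₅ : ℝ} {w v : SchwartzMap (EuclideanSpace ℝ (Fin 4)) ℝ} (hε : 0 < ε₁)
    (hwin : ∀ Λ₆ : ℝ, ∃ β₆ : ℝ, ∀ β : ℝ, β₅ ≤ β → β₆ ≤ β → ∀ L : ℕ, Λ₅ ≤ a β * L → a β * L ≤ Λ₆ →
      ε₁ ≤ |resp G r a ρ₀ w v β L|) :
    ∃ C β₀ : ℝ, 0 ≤ C ∧ ∀ β : ℝ, β₀ ≤ β → a β ^ 8 ≤ C * (1 + Real.log β) / β := by
  obtain ⟨Cw, hw⟩ := exists_abs_le_of_schwartz w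
  obtain ⟨Cv, hv⟩ := exists_abs_le_of_schwartz v
  obtain ⟨K, hK0, hK⟩ := abs_resp_le_weakCoupling G r ρ₀ hw hv
  set M : ℝ := max Λ₅ 1 with hM
  have hM1 : 1 ≤ M := le_max_right _ _
  have hM0 : 0 < M := lt_of_lt_of_le one_pos hM1
  have hM5 : Λ₅ ≤ M := le_max_left _ _
  obtain ⟨β₆, hβ₆⟩ := hwin (M + 1)
  obtain ⟨βa, hβa⟩ : ∃ βa : ℝ, ∀ β, βa ≤ β → a β ≤ 1 :=
    eventually_atTop.1 (ha0.eventually (eventually_le_nhds one_pos))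
  refine ⟨K * (5 * M) ^ 8 / ε₁, max (max β₅ β₆) (max βa 1), by positivity, fun β hβ => ?_⟩
  have hβ5 : β₅ ≤ β := le_trans (le_trans (le_max_left _ _) (le_max_left _ _)) hβ
  have hβ6 : β₆ ≤ β := le_trans (le_trans (le_max_right _ _) (le_max_left _ _)) hβ
  have hβa' : βa ≤ β := le_trans (le_trans (le_max_left _ _) (le_max_right _ _)) hβ
  have hβ1 : 1 ≤ β := le_trans (le_trans (le_max_right _ _) (le_max_right _ _)) hβ
  have haβ : 0 < a β := ha β
  have ha1 : a β ≤ 1 := hβa β hβa'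
  have hx : 0 < M / a β := div_pos hM0 haβ
  set L : ℕ := ⌈M / a β⌉₊ with hL
  have hL1 : 1 ≤ L := Nat.one_le_iff_ne_zero.2 (Nat.pos_iff_ne_zero.1 (Nat.ceil_pos.2 hx))
  have hLlo : M ≤ a β * (L : ℝ) := by
    have h : M / a β ≤ (L : ℝ) := Nat.le_ceil _
    calc M = a β * (M / a β) := by field_simp
      _ ≤ a β * (L : ℝ) := mul_le_mul_of_nonneg_left h haβ.le
  have hLhi : a β * (L : ℝ) ≤ M + 1 := by
    have h : (L : ℝ) < M / a β + 1 := Nat.ceil_lt_add_one hx.le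
    have h' : a β * (L : ℝ) ≤ a β * (M / a β + 1) := mul_le_mul_of_nonneg_left h.le haβ.le
    calc a β * (L : ℝ) ≤ a β * (M / a β + 1) := h'
      _ = M + a β := by field_simp
      _ ≤ M + 1 := by linarith
  have hfloor : ε₁ ≤ |resp G r a ρ₀ w v β L| := hβ₆ β hβ5 hβ6 L (hM5.trans hLlo) hLhi
  have hbound := hK a L hL1 β hβ1
  -- size of the admissible torus in units of `1/a(β)`
  have hn : ((2 * L + 1 : ℕ) : ℝ) ≤ 5 * M / a β := by
    have h : (L : ℝ) < M / a β + 1 := Nat.ceil_lt_add_one hx.le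
    have hMa : 1 ≤ M / a β := by
      rw [le_div_iff₀ haβ]; linarith
    push_cast
    have : (5 : ℝ) * M / a β = 5 * (M / a β) := by ring
    rw [this]
    linarith
  have hpow : ((2 * L + 1 : ℕ) : ℝ) ^ 8 ≤ (5 * M / a β) ^ 8 := pow_le_pow_left₀ (by positivity) hn 8
  have hlog : 0 ≤ (1 + Real.log β) / β := div_nonneg (by linarith [Real.log_nonneg hβ1]) (by linarith)
  have h3 : ε₁ ≤ K * (5 * M / a β) ^ 8 * ((1 + Real.log β) / β) := by
    refine hfloor.trans (hbound.trans ?_)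
    rw [mul_div_assoc]
    exact mul_le_mul_of_nonneg_right (mul_le_mul_of_nonneg_left hpow hK0) hlog
  have ha8 : 0 < a β ^ 8 := by positivity
  have h4 : a β ^ 8 * ε₁ ≤ K * (5 * M) ^ 8 * ((1 + Real.log β) / β) := by
    have h := mul_le_mul_of_nonneg_left h3 ha8.le
    calc a β ^ 8 * ε₁ ≤ a β ^ 8 * (K * (5 * M / a β) ^ 8 * ((1 + Real.log β) / β)) := h
      _ = K * (5 * M) ^ 8 * ((1 + Real.log β) / β) := by
          rw [div_pow]
          field_simp
  calc a β ^ 8 = a β ^ 8 * ε₁ / ε₁ := by field_simp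
    _ ≤ K * (5 * M) ^ 8 * ((1 + Real.log β) / β) / ε₁ := div_le_div_of_nonneg_right h4 hε.le
    _ = K * (5 * M) ^ 8 / ε₁ * (1 + Real.log β) / β := by ring

/-- **THE WITNESS UNIT IS PINNED FROM BELOW (crux form).**  If `(r, a)` carries the floor data of the crux
`FlowedResponseFloor` at one radius (`ε₁ ≤ |resp(β, L)|` for all `β ≥ β₅` on ALL tori `a(β)L ≥ Λ₅`), then
`a(β)⁸ ≤ C (1 + log β)/β` for all large `β`. -/
theorem unit_pow_le_of_floor {a : ℝ → ℝ} (ha : ∀ β, 0 < a β) (ha0 : Tendsto a atTop (𝓝 0))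
    {ρ₀ ε₁ β₅ Λ₅ : ℝ} {w v : SchwartzMap (EuclideanSpace ℝ (Fin 4)) ℝ} (hε : 0 < ε₁)
    (hfl : ∀ β : ℝ, β₅ ≤ β → ∀ L : ℕ, Λ₅ ≤ a β * L → ε₁ ≤ |resp G r a ρ₀ w v β L|) :
    ∃ C β₀ : ℝ, 0 ≤ C ∧ ∀ β : ℝ, β₀ ≤ β → a β ^ 8 ≤ C * (1 + Real.log β) / β :=
  unit_pow_le_of_windowFloor G r ha ha0 hε fun _ => ⟨β₅, fun β hβ _ L hL _ => hfl β hβ L hL⟩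

/-- For `0 < s` and any `C`: eventually `C (1 + log β) ≤ β^s` (`log β = o(β^s)`). [folklore] -/
theorem eventually_mul_one_add_log_le_rpow (C : ℝ) {s : ℝ} (hs : 0 < s) :
    ∀ᶠ β : ℝ in atTop, C * (1 + Real.log β) ≤ β ^ s := by
  have h1 : (fun _ : ℝ => (1 : ℝ)) =o[atTop] fun β : ℝ => β ^ s := by
    refine (Asymptotics.isLittleO_const_left).2 (Or.inr ?_)
    exact tendsto_norm_atTop_atTop.comp (tendsto_rpow_atTop hs)
  have h2 : Real.log =o[atTop] fun β : ℝ => β ^ s := isLittleO_log_rpow_atTop hs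
  have h3 : (fun β : ℝ => C * (1 + Real.log β)) =o[atTop] fun β : ℝ => β ^ s :=
    (h1.add h2).const_mul_left C
  filter_upwards [h3.def one_pos, eventually_ge_atTop (0 : ℝ)] with β hβ hβ0
  rw [one_mul, Real.norm_eq_abs, Real.norm_eq_abs, abs_of_nonneg (Real.rpow_nonneg hβ0 s)] at hβ
  exact (le_abs_self _).trans hβ

/-- **No power-law unit can witness the floor.**  Under the hypotheses of `unit_pow_le_of_windowFloor`, for every
exponent `c < 1/8`: `a(β) ≤ β^{−c}` for all large `β`.  (In particular `a(β) = β^{−c₀}`, `(log β)^{−k}`, … are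
excluded; so is any unit with `limsup a(β)·β^{c} = ∞` for some `c < 1/8`.) -/
theorem eventually_unit_le_rpow_of_windowFloor {a : ℝ → ℝ} (ha : ∀ β, 0 < a β) (ha0 : Tendsto a atTop (𝓝 0))
    {ρ₀ ε₁ β₅ Λ₅ : ℝ} {w v : SchwartzMap (EuclideanSpace ℝ (Fin 4)) ℝ} (hε : 0 < ε₁)
    (hwin : ∀ Λ₆ : ℝ, ∃ β₆ : ℝ, ∀ β : ℝ, β₅ ≤ β → β₆ ≤ β → ∀ L : ℕ, Λ₅ ≤ a β * L → a β * L ≤ Λ₆ →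
      ε₁ ≤ |resp G r a ρ₀ w v β L|) {c : ℝ} (hc : c < 1 / 8) :
    ∀ᶠ β : ℝ in atTop, a β ≤ β ^ (-c) := by
  obtain ⟨C, β₀, -, hC⟩ := unit_pow_le_of_windowFloor G r ha ha0 hε hwin
  have hs : 0 < 1 - 8 * c := by linarith
  filter_upwards [eventually_ge_atTop β₀, eventually_ge_atTop (1 : ℝ),
    eventually_mul_one_add_log_le_rpow C hs] with β hβ hβ1 hlog
  have hβ0 : 0 < β := lt_of_lt_of_le one_pos hβ1
  have h1 : a β ^ 8 ≤ β ^ (1 - 8 * c) / β := by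
    refine (hC β hβ).trans ?_
    rw [mul_div_assoc, ← mul_div_assoc]
    exact div_le_div_of_nonneg_right hlog hβ0.le
  have h2 : β ^ (1 - 8 * c) / β = (β ^ (-c)) ^ 8 := by
    rw [← Real.rpow_sub_one hβ0.ne', ← Real.rpow_mul_natCast hβ0.le]
    congr 1
    push_cast
    ring
  rw [h2] at h1
  exact (pow_le_pow_iff_left₀ (ha β).le (Real.rpow_nonneg hβ0.le _) (by norm_num)).1 h1

end Pinning

end Summit.QuantumFields.YangMills.Cruxes.FlowedResponseFloor.WindowSplit

end
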